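import Mathlib.Data.Fin.Tuple.Basic
import Mathlib.Data.Set.Finite.Lattice
import Mathlib.Data.Fintype.Pi
import Mathlib.Order.CompleteLattice.Finset
import HarnessLib

/-!
# The fibre-counting dimension of a subset of `K^n` (combinatorial part)

Topic `Literature/ModelTheory/PseudofiniteFields`.  For a subset `X ⊆ K^n` of a power of an
arbitrary type `K` we define the predicate **`DimAtLeast n X e`** ("the fibre-counting dimension
of `X` is at least `e`") by recursion on `n`, fibring over the first `n − 1` coordinates:

* `DimAtLeast 0 X e :↔ X ≠ ∅ ∧ e = 0`;
* `DimAtLeast (n+1) X e :↔ DimAtLeast n (finBase X) e ∨ DimAtLeast n (infBase X) (e − 1)`,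
  where `finBase X = {p ∈ K^n | the fibre X_p ⊆ K is finite and nonempty}` and
  `infBase X = {p ∈ K^n | X_p is infinite}` (`lastFibre X p = X_p = {t | (p, t) ∈ X}`).

Over a PSEUDO-FINITE field and for DEFINABLE `X` this is the dimension of
Chatzidakis–van den Dries–Macintyre [ChatzidakisVanDenDriesMacintyre1992, Main Theorem and
Prop. 3.3]: a definable subset of `K` is finite or of "dimension 1", and the recursion is the
fibration step of their counting (made precise through the companion predicate with explicit
finiteness thresholds and its transfer to finite fields, `CountingDimensionDefinable.lean`).
This file is the PURELY COMBINATORIAL part, valid for arbitrary subsets of arbitrary powers: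

* `dimAtLeast_zero_iff` (`e = 0` ↔ nonempty), `DimAtLeast.le` (`e ≤ n`), `DimAtLeast.anti`
  (downward closed in `e`), `DimAtLeast.mono` / `dimAtLeast_union_iff` (monotone in `X`,
  finite unions split), `dimAtLeast_one_iff` (`e = 1` ↔ infinite);
* slicing along the FIRST coordinate (`slice X b = {x ∈ X | x 0 = b}`):
  `not_dimAtLeast_succ_of_forall_slice` (all slices of dimension `< d` ⇒ dimension `< d + 1`)
  and `dimAtLeast_succ_of_infinite_slices` (infinitely many slices of dimension `≥ d` ⇒
  dimension `≥ d + 1`).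

The first coordinate is special: it stays a base coordinate at every level of the recursion
down to level `1`, where everything is trivial; for other coordinates (and for coordinate
permutations) the corresponding statements FAIL for arbitrary sets (`{(p, t) | t ≻ p}` for a
well-ordering `≺` of type `ω` of a countable `K` has dimension `≥ 2`, its transpose has not) and
hold for definable sets over pseudo-finite fields only (`CountingDimensionDefinable.lean`).

## References

* [ChatzidakisVanDenDriesMacintyre1992] Z. Chatzidakis, L. van den Dries, A. Macintyre,
  Definable sets over finite fields, J. reine angew. Math. 427 (1992) 107–135, §3.
-/

namespace Literature.ModelTheory.PseudofiniteFields

variable {K : Type*}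

section Defs

/-- The fibre of `X ⊆ K^{n+1}` over `p ∈ K^n` (first `n` coordinates):
`X_p = {t | (p, t) ∈ X}`. [folklore] -/
def lastFibre {n : ℕ} (X : Set (Fin (n + 1) → K)) (p : Fin n → K) : Set K :=
  {t | (Fin.snoc p t : Fin (n + 1) → K) ∈ X}

/-- The points of the base `K^n` over which `X ⊆ K^{n+1}` has a FINITE NONEMPTY fibre.
[folklore] -/
def finBase {n : ℕ} (X : Set (Fin (n + 1) → K)) : Set (Fin n → K) :=
  {p | (lastFibre X p).Finite ∧ (lastFibre X p).Nonempty}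

/-- The points of the base `K^n` over which `X ⊆ K^{n+1}` has an INFINITE fibre. [folklore] -/
def infBase {n : ℕ} (X : Set (Fin (n + 1) → K)) : Set (Fin n → K) :=
  {p | (lastFibre X p).Infinite}

/-- **The fibre-counting dimension is at least `e`** (`DimAtLeast n X e`, `X ⊆ K^n`), by
recursion on `n`: in `K^0` only the nonempty set has dimension `≥ 0` and nothing more; in
`K^{n+1}`, `X` has dimension `≥ e` iff the base of its finite nonempty fibres has dimension
`≥ e` or the base of its infinite fibres has dimension `≥ e − 1`.  [folklore] (For a definable
set over a pseudo-finite field this is "`d ≥ e`" for the dimension `d` of the counting theorem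
of [ChatzidakisVanDenDriesMacintyre1992, Main Theorem]: `|X(𝔽_q)| ≍ q^d`; see
`CountingDimensionDefinable.lean`.) -/
def DimAtLeast : (n : ℕ) → Set (Fin n → K) → ℕ → Prop
  | 0, X, e => X.Nonempty ∧ e = 0
  | n + 1, X, e => DimAtLeast n (finBase X) e ∨ DimAtLeast n (infBase X) (e - 1)

/-- The slice of `X ⊆ K^{n+1}` at first coordinate `b`. [folklore] -/
def slice {n : ℕ} (X : Set (Fin (n + 1) → K)) (b : K) : Set (Fin (n + 1) → K) :=
  {x | x ∈ X ∧ x 0 = b}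

end Defs

section Basic

variable {n : ℕ}

/-- Membership in a fibre. [folklore] -/
@[simp] theorem mem_lastFibre (X : Set (Fin (n + 1) → K)) (p : Fin n → K) (t : K) :
    t ∈ lastFibre X p ↔ (Fin.snoc p t : Fin (n + 1) → K) ∈ X := Iff.rfl

/-- Membership in the base of finite nonempty fibres. [folklore] -/
@[simp] theorem mem_finBase (X : Set (Fin (n + 1) → K)) (p : Fin n → K) :
    p ∈ finBase X ↔ (lastFibre X p).Finite ∧ (lastFibre X p).Nonempty := Iff.rfl

/-- Membership in the base of infinite fibres. [folklore] -/
@[simp] theorem mem_infBase (X : Set (Fin (n + 1) → K)) (p : Fin n → K) :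
    p ∈ infBase X ↔ (lastFibre X p).Infinite := Iff.rfl

/-- Membership in a slice. [folklore] -/
@[simp] theorem mem_slice (X : Set (Fin (n + 1) → K)) (b : K) (x : Fin (n + 1) → K) :
    x ∈ slice X b ↔ x ∈ X ∧ x 0 = b := Iff.rfl

/-- Unfolding of the dimension predicate in `K^0`. [folklore] -/
theorem dimAtLeast_zero_level (X : Set (Fin 0 → K)) (e : ℕ) :
    DimAtLeast 0 X e ↔ X.Nonempty ∧ e = 0 := Iff.rfl

/-- Unfolding of the dimension predicate in `K^{n+1}`. [folklore] -/
theorem dimAtLeast_succ (X : Set (Fin (n + 1) → K)) (e : ℕ) :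
    DimAtLeast (n + 1) X e ↔ DimAtLeast n (finBase X) e ∨ DimAtLeast n (infBase X) (e - 1) :=
  Iff.rfl

/-- A slice is a subset. [folklore] -/
theorem slice_subset (X : Set (Fin (n + 1) → K)) (b : K) : slice X b ⊆ X := fun _ hx => hx.1

/-- A point lies in the slice at its own first coordinate. [folklore] -/
theorem mem_slice_self {X : Set (Fin (n + 1) → K)} {x : Fin (n + 1) → K} (hx : x ∈ X) :
    x ∈ slice X (x 0) := ⟨hx, rfl⟩

/-- Fibres are monotone in the set. [folklore] -/
theorem lastFibre_mono {X Y : Set (Fin (n + 1) → K)} (h : X ⊆ Y) (p : Fin n → K) :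
    lastFibre X p ⊆ lastFibre Y p := fun _ ht => h ht

/-- Fibres of a union. [folklore] -/
theorem lastFibre_union (X Y : Set (Fin (n + 1) → K)) (p : Fin n → K) :
    lastFibre (X ∪ Y) p = lastFibre X p ∪ lastFibre Y p := rfl

/-- The base of infinite fibres is monotone in the set. [folklore] -/
theorem infBase_mono {X Y : Set (Fin (n + 1) → K)} (h : X ⊆ Y) : infBase X ⊆ infBase Y :=
  fun p hp => Set.Infinite.mono (lastFibre_mono h p) hp

/-- The base of infinite fibres of a union. [folklore] -/
theorem infBase_union (X Y : Set (Fin (n + 1) → K)) : infBase (X ∪ Y) = infBase X ∪ infBase Y := by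
  ext p
  simp only [mem_infBase, lastFibre_union, Set.infinite_union, Set.mem_union]

/-- A finite nonempty fibre of a subset lies under a finite nonempty or an infinite fibre of the
superset. [folklore] -/
theorem finBase_subset_union {X Y : Set (Fin (n + 1) → K)} (h : X ⊆ Y) :
    finBase X ⊆ finBase Y ∪ infBase Y := by
  intro p hp
  by_cases hfin : (lastFibre Y p).Finite
  · exact Or.inl ⟨hfin, hp.2.mono (lastFibre_mono h p)⟩
  · exact Or.inr hfin

/-- The base of finite nonempty fibres of a union. [folklore] -/
theorem finBase_union_subset (X Y : Set (Fin (n + 1) → K)) :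
    finBase (X ∪ Y) ⊆ finBase X ∪ finBase Y := by
  intro p hp
  rw [mem_finBase, lastFibre_union, Set.finite_union, Set.union_nonempty] at hp
  rcases hp.2 with h | h
  · exact Or.inl ⟨hp.1.1, h⟩
  · exact Or.inr ⟨hp.1.2, h⟩

/-- Every point of `X` lies over a point of `finBase X ∪ infBase X`. [folklore] -/
theorem init_mem_finBase_union_infBase {X : Set (Fin (n + 1) → K)} {x : Fin (n + 1) → K}
    (hx : x ∈ X) : Fin.init x ∈ finBase X ∪ infBase X := by
  have hne : (lastFibre X (Fin.init x)).Nonempty :=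
    ⟨x (Fin.last n), by rw [mem_lastFibre, Fin.snoc_init_self]; exact hx⟩
  by_cases hfin : (lastFibre X (Fin.init x)).Finite
  · exact Or.inl ⟨hfin, hne⟩
  · exact Or.inr hfin

end Basic

section Rules

variable {n : ℕ}

/-- **Dimension `≥ 0` means nonempty.** [folklore] -/
theorem dimAtLeast_zero_iff : ∀ {n : ℕ} (X : Set (Fin n → K)), DimAtLeast n X 0 ↔ X.Nonempty
  | 0, X => by rw [dimAtLeast_zero_level]; exact ⟨fun h => h.1, fun h => ⟨h, rfl⟩⟩
  | n + 1, X => by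
    rw [dimAtLeast_succ, Nat.zero_sub, dimAtLeast_zero_iff, dimAtLeast_zero_iff]
    constructor
    · rintro (⟨p, hp⟩ | ⟨p, hp⟩)
      · obtain ⟨t, ht⟩ := hp.2
        exact ⟨_, ht⟩
      · obtain ⟨t, ht⟩ := hp.nonempty
        exact ⟨_, ht⟩
    · rintro ⟨x, hx⟩
      rcases init_mem_finBase_union_infBase hx with h | h
      · exact Or.inl ⟨_, h⟩
      · exact Or.inr ⟨_, h⟩

/-- The empty set has no dimension. [folklore] -/
theorem not_dimAtLeast_empty : ∀ {n : ℕ} (e : ℕ), ¬ DimAtLeast n (∅ : Set (Fin n → K)) e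
  | 0, e => by rw [dimAtLeast_zero_level]; exact fun h => Set.not_nonempty_empty h.1
  | n + 1, e => by
    have hfin : finBase (∅ : Set (Fin (n + 1) → K)) = ∅ := by
      ext p; simp [finBase, lastFibre]
    have hinf : infBase (∅ : Set (Fin (n + 1) → K)) = ∅ := by
      ext p; simp [infBase, lastFibre]
    rw [dimAtLeast_succ, hfin, hinf]
    exact fun h => h.elim (not_dimAtLeast_empty e) (not_dimAtLeast_empty (e - 1))

/-- **The dimension is at most the number of coordinates.** [folklore] -/
theorem DimAtLeast.le : ∀ {n : ℕ} {X : Set (Fin n → K)} {e : ℕ}, DimAtLeast n X e → e ≤ n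
  | 0, _, _, h => h.2.le
  | n + 1, _, e, h => by
    rcases (dimAtLeast_succ _ _).1 h with h | h
    · exact (DimAtLeast.le h).trans (Nat.le_succ n)
    · have := DimAtLeast.le h
      omega

/-- **Downward closure in `e`.** [folklore] -/
theorem DimAtLeast.anti : ∀ {n : ℕ} {X : Set (Fin n → K)} {e e' : ℕ},
    DimAtLeast n X e → e' ≤ e → DimAtLeast n X e'
  | 0, _, _, _, h, hle => ⟨h.1, Nat.eq_zero_of_le_zero (h.2 ▸ hle)⟩
  | n + 1, X, e, e', h, hle => by
    rcases (dimAtLeast_succ _ _).1 h with h | h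
    · exact Or.inl (h.anti hle)
    · exact Or.inr (h.anti (Nat.sub_le_sub_right hle 1))

/-- A set of some dimension is nonempty. [folklore] -/
theorem DimAtLeast.nonempty {X : Set (Fin n → K)} {e : ℕ} (h : DimAtLeast n X e) : X.Nonempty :=
  (dimAtLeast_zero_iff X).1 (h.anti (Nat.zero_le e))

/-- **Monotonicity in the set, and splitting of finite unions** (proved together, by induction
on the level). [folklore] -/
theorem dimAtLeast_mono_and_union : ∀ (n : ℕ),
    (∀ (X Y : Set (Fin n → K)) (e : ℕ), X ⊆ Y → DimAtLeast n X e → DimAtLeast n Y e) ∧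
    (∀ (X Y : Set (Fin n → K)) (e : ℕ),
      DimAtLeast n (X ∪ Y) e → DimAtLeast n X e ∨ DimAtLeast n Y e)
  | 0 => ⟨fun X Y e hXY h => ⟨h.1.mono hXY, h.2⟩, fun X Y e h => by
      rw [dimAtLeast_zero_level, Set.union_nonempty] at h
      exact h.1.elim (fun hX => Or.inl ⟨hX, h.2⟩) (fun hY => Or.inr ⟨hY, h.2⟩)⟩
  | n + 1 => by
    obtain ⟨hmono, hunion⟩ := dimAtLeast_mono_and_union n
    refine ⟨fun X Y e hXY h => ?_, fun X Y e h => ?_⟩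
    · rcases (dimAtLeast_succ _ _).1 h with h | h
      · rcases hunion _ _ _ (hmono _ _ _ (finBase_subset_union hXY) h) with h' | h'
        · exact Or.inl h'
        · exact Or.inr (h'.anti (Nat.sub_le e 1))
      · exact Or.inr (hmono _ _ _ (infBase_mono hXY) h)
    · rcases (dimAtLeast_succ _ _).1 h with h | h
      · rcases hunion _ _ _ (hmono _ _ _ (finBase_union_subset X Y) h) with h' | h'
        · exact Or.inl (Or.inl h')
        · exact Or.inr (Or.inl h')
      · rw [infBase_union] at h
        rcases hunion _ _ _ h with h' | h'
        · exact Or.inl (Or.inr h')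
        · exact Or.inr (Or.inr h')

/-- **Monotonicity**: a superset has at least the dimension. [folklore] -/
theorem DimAtLeast.mono {X Y : Set (Fin n → K)} {e : ℕ} (h : DimAtLeast n X e) (hXY : X ⊆ Y) :
    DimAtLeast n Y e :=
  (dimAtLeast_mono_and_union n).1 X Y e hXY h

/-- **Binary unions split.** [folklore] -/
theorem dimAtLeast_union_iff {X Y : Set (Fin n → K)} {e : ℕ} :
    DimAtLeast n (X ∪ Y) e ↔ DimAtLeast n X e ∨ DimAtLeast n Y e :=
  ⟨(dimAtLeast_mono_and_union n).2 X Y e,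
    fun h => h.elim (fun h => h.mono Set.subset_union_left) (fun h => h.mono Set.subset_union_right)⟩

/-- **Finite unions split**: if `⋃_i X_i` (finitely many) has dimension `≥ e`, some `X_i` has.
[folklore] -/
theorem exists_dimAtLeast_of_iUnion {ι : Type*} [Finite ι] {X : ι → Set (Fin n → K)} {e : ℕ}
    (h : DimAtLeast n (⋃ i, X i) e) : ∃ i, DimAtLeast n (X i) e := by
  classical
  haveI := Fintype.ofFinite ι
  -- induction over finsets of indices
  suffices H : ∀ s : Finset ι, DimAtLeast n (⋃ i ∈ s, X i) e → ∃ i, DimAtLeast n (X i) e by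
    refine H Finset.univ (h.mono ?_)
    exact Set.iUnion_subset fun i => Set.subset_biUnion_of_mem (Finset.mem_coe.2 (Finset.mem_univ i))
  intro s
  induction s using Finset.induction_on with
  | empty =>
    intro h0
    simp only [Finset.notMem_empty, Set.iUnion_of_empty, Set.iUnion_empty] at h0
    exact absurd h0 (not_dimAtLeast_empty e)
  | insert a s ha ih =>
    intro h1
    rw [Finset.set_biUnion_insert, dimAtLeast_union_iff] at h1
    exact h1.elim (fun h => ⟨a, h⟩) ih

/-- **Covering bound**: if `X ⊆ ⋃_i Z_i` (finitely many) and no `Z_i` has dimension `≥ e`,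
then `X` has not. [folklore] -/
theorem not_dimAtLeast_of_subset_iUnion {ι : Type*} [Finite ι] {X : Set (Fin n → K)}
    {Z : ι → Set (Fin n → K)} {e : ℕ} (hXZ : X ⊆ ⋃ i, Z i) (hZ : ∀ i, ¬ DimAtLeast n (Z i) e) :
    ¬ DimAtLeast n X e := fun h => by
  obtain ⟨i, hi⟩ := exists_dimAtLeast_of_iUnion (h.mono hXZ)
  exact hZ i hi

/-- **Dimension `≥ 1` means infinite.** [folklore] -/
theorem dimAtLeast_one_iff : ∀ {n : ℕ} (X : Set (Fin n → K)), DimAtLeast n X 1 ↔ X.Infinite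
  | 0, X => by
    rw [dimAtLeast_zero_level]
    exact ⟨fun h => absurd h.2 one_ne_zero, fun h => absurd (Set.toFinite X) h⟩
  | n + 1, X => by
    rw [dimAtLeast_succ, Nat.sub_self, dimAtLeast_one_iff, dimAtLeast_zero_iff]
    constructor
    · rintro (hfin | ⟨p, hp⟩)
      · -- infinitely many nonempty fibres
        intro hX
        apply hfin
        refine (hX.image Fin.init).subset fun p hp => ?_
        obtain ⟨t, ht⟩ := hp.2
        exact ⟨_, ht, Fin.init_snoc _ _⟩
      · -- one infinite fibre
        intro hX
        apply hp
        exact (hX.preimage (f := fun t : K => (Fin.snoc p t : Fin (n + 1) → K))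
          fun t _ t' _ htt' => by simpa using congrFun htt' (Fin.last n))
    · intro hX
      by_contra hcon
      push Not at hcon
      obtain ⟨hfin, hinf⟩ := hcon
      apply hX
      -- all fibres finite, finitely many of them nonempty
      have hcov : X ⊆ ⋃ p ∈ finBase X,
          (fun t : K => (Fin.snoc p t : Fin (n + 1) → K)) '' lastFibre X p := by
        intro x hx
        have hp : Fin.init x ∈ finBase X := by
          rcases init_mem_finBase_union_infBase hx with h | h
          · exact h
          · rw [hinf] at h; exact h.elim
        refine Set.mem_biUnion hp ⟨x (Fin.last n), ?_, Fin.snoc_init_self _⟩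
        rw [mem_lastFibre, Fin.snoc_init_self]
        exact hx
      exact (hfin.biUnion fun p hp => hp.1.image _).subset hcov

/-- A finite set has dimension `< 1`. [folklore] -/
theorem not_dimAtLeast_one_of_finite {X : Set (Fin n → K)} (hX : X.Finite) : ¬ DimAtLeast n X 1 :=
  fun h => ((dimAtLeast_one_iff X).1 h) hX

/-- A finite set has dimension `< e` for every `e ≥ 1`. [folklore] -/
theorem not_dimAtLeast_of_finite {X : Set (Fin n → K)} (hX : X.Finite) {e : ℕ} (he : 1 ≤ e) :
    ¬ DimAtLeast n X e :=
  fun h => not_dimAtLeast_one_of_finite hX (h.anti he)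

/-! ### Slicing along the first coordinate -/

/-- Fibres of a slice (level `≥ 2`, so that the first coordinate is a base coordinate): the
fibre of `slice X b` over `p` is the fibre of `X` if `p 0 = b` and empty otherwise. [folklore] -/
theorem lastFibre_slice (X : Set (Fin (n + 2) → K)) (b : K) (p : Fin (n + 1) → K) :
    lastFibre (slice X b) p = {t | t ∈ lastFibre X p ∧ p 0 = b} := by
  ext t
  simp only [mem_lastFibre, mem_slice, Fin.snoc_apply_zero, Set.mem_setOf_eq]

/-- Fibres of a slice over points of the slice's hyperplane. [folklore] -/
theorem lastFibre_slice_of_eq {X : Set (Fin (n + 2) → K)} {b : K} {p : Fin (n + 1) → K}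
    (h : p 0 = b) : lastFibre (slice X b) p = lastFibre X p := by
  rw [lastFibre_slice]
  ext t
  simp only [Set.mem_setOf_eq, h, and_true]

/-- Fibres of a slice off the slice's hyperplane are empty. [folklore] -/
theorem lastFibre_slice_of_ne {X : Set (Fin (n + 2) → K)} {b : K} {p : Fin (n + 1) → K}
    (h : p 0 ≠ b) : lastFibre (slice X b) p = ∅ := by
  rw [lastFibre_slice]
  exact Set.eq_empty_of_forall_notMem fun t ht => h ht.2

/-- The base of finite nonempty fibres of a slice is the slice of the base. [folklore] -/
theorem finBase_slice (X : Set (Fin (n + 2) → K)) (b : K) :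
    finBase (slice X b) = slice (finBase X) b := by
  ext p
  by_cases h : p 0 = b
  · simp only [mem_finBase, lastFibre_slice_of_eq h, mem_slice, h, and_true]
  · simp only [mem_finBase, lastFibre_slice_of_ne h, mem_slice, h, and_false, iff_false, not_and]
    exact fun _ hne => Set.not_nonempty_empty hne

/-- The base of infinite fibres of a slice is the slice of the base. [folklore] -/
theorem infBase_slice (X : Set (Fin (n + 2) → K)) (b : K) :
    infBase (slice X b) = slice (infBase X) b := by
  ext p
  by_cases h : p 0 = b
  · simp only [mem_infBase, lastFibre_slice_of_eq h, mem_slice, h, and_true]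
  · simp only [mem_infBase, lastFibre_slice_of_ne h, mem_slice, h, and_false, iff_false]
    exact fun hinf => hinf Set.finite_empty

/-- If all slices are empty, the set is empty. [folklore] -/
theorem eq_empty_of_forall_slice_eq_empty {X : Set (Fin (n + 1) → K)}
    (h : ∀ b, slice X b = ∅) : X = ∅ :=
  Set.eq_empty_of_forall_notMem fun x hx => by
    have := mem_slice_self hx
    rw [h] at this
    exact this

/-- Infinitely many nonempty slices make an infinite set. [folklore] -/
theorem infinite_of_infinite_nonempty_slices {X : Set (Fin (n + 1) → K)}
    (h : {b | (slice X b).Nonempty}.Infinite) : X.Infinite := by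
  intro hX
  apply h
  refine (hX.image fun x => x 0).subset fun b hb => ?_
  obtain ⟨x, hx, hx0⟩ := hb
  exact ⟨x, hx, hx0⟩

/-- **Upper slicing rule (first coordinate)**: if every slice `{x ∈ X | x 0 = b}` has dimension
`< d`, then `X` has dimension `< d + 1`. [folklore] -/
theorem not_dimAtLeast_succ_of_forall_slice : ∀ {n : ℕ} (X : Set (Fin (n + 1) → K)) (d : ℕ),
    (∀ b, ¬ DimAtLeast (n + 1) (slice X b) d) → ¬ DimAtLeast (n + 1) X (d + 1)
  | 0, X, d, h => by
    rcases Nat.eq_zero_or_pos d with rfl | hd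
    · -- all slices empty
      have hX : X = ∅ := eq_empty_of_forall_slice_eq_empty fun b =>
        Set.not_nonempty_iff_eq_empty.1 fun hne => h b ((dimAtLeast_zero_iff _).2 hne)
      rw [hX]
      exact not_dimAtLeast_empty 1
    · intro hX
      have := hX.le
      omega
  | n + 1, X, d, h => by
    rcases Nat.eq_zero_or_pos d with rfl | hd
    · have hX : X = ∅ := eq_empty_of_forall_slice_eq_empty fun b =>
        Set.not_nonempty_iff_eq_empty.1 fun hne => h b ((dimAtLeast_zero_iff _).2 hne)
      rw [hX]
      exact not_dimAtLeast_empty 1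
    · obtain ⟨d', rfl⟩ : ∃ d', d = d' + 1 := ⟨d - 1, by omega⟩
      have hfin : ∀ b, ¬ DimAtLeast (n + 1) (slice (finBase X) b) (d' + 1) := fun b hb =>
        h b (Or.inl (by rw [finBase_slice]; exact hb))
      have hinf : ∀ b, ¬ DimAtLeast (n + 1) (slice (infBase X) b) d' := fun b hb =>
        h b (Or.inr (by rw [infBase_slice, Nat.add_sub_cancel]; exact hb))
      rintro (hX | hX)
      · exact not_dimAtLeast_succ_of_forall_slice (finBase X) (d' + 1) hfin hX
      · rw [Nat.add_sub_cancel] at hX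
        exact not_dimAtLeast_succ_of_forall_slice (infBase X) d' hinf hX

/-- **Lower slicing rule (first coordinate)**: if infinitely many slices `{x ∈ X | x 0 = b}`
have dimension `≥ d`, then `X` has dimension `≥ d + 1`. [folklore] -/
theorem dimAtLeast_succ_of_infinite_slices : ∀ {n : ℕ} (X : Set (Fin (n + 1) → K)) (d : ℕ),
    {b | DimAtLeast (n + 1) (slice X b) d}.Infinite → DimAtLeast (n + 1) X (d + 1)
  | 0, X, d, h => by
    rcases Nat.eq_zero_or_pos d with rfl | hd
    · -- infinitely many nonempty slices: `X` is infinite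
      change DimAtLeast (0 + 1) X 1
      rw [dimAtLeast_one_iff]
      refine infinite_of_infinite_nonempty_slices (h.mono fun b hb => ?_)
      exact (dimAtLeast_zero_iff _).1 hb
    · -- slices are subsingletons, of dimension `< 1`: the set of such `b` is empty
      exfalso
      apply h
      convert Set.finite_empty
      refine Set.eq_empty_of_forall_notMem fun b hb => ?_
      refine not_dimAtLeast_of_finite ?_ hd hb
      refine Set.Finite.subset (Set.finite_singleton fun _ : Fin 1 => b) fun x hx => ?_
      rw [Set.mem_singleton_iff]
      funext i
      rw [Fin.fin_one_eq_zero i]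
      exact hx.2
  | n + 1, X, d, h => by
    -- split according to the two branches of the recursion for the slices
    have hsub : {b | DimAtLeast (n + 2) (slice X b) d} ⊆
        {b | DimAtLeast (n + 1) (slice (finBase X) b) d} ∪
          {b | DimAtLeast (n + 1) (slice (infBase X) b) (d - 1)} := by
      intro b hb
      rcases (dimAtLeast_succ _ _).1 hb with hb | hb
      · left
        show DimAtLeast (n + 1) (slice (finBase X) b) d
        rw [← finBase_slice]; exact hb
      · right
        show DimAtLeast (n + 1) (slice (infBase X) b) (d - 1)
        rw [← infBase_slice]; exact hb
    rcases Set.infinite_union.1 (h.mono hsub) with hA | hB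
    · exact Or.inl (dimAtLeast_succ_of_infinite_slices (finBase X) d hA)
    · rcases Nat.eq_zero_or_pos d with rfl | hd
      · -- `d = 0`: infinitely many nonempty slices of `infBase X`
        have hinf : (infBase X).Infinite :=
          infinite_of_infinite_nonempty_slices (hB.mono fun b hb => (dimAtLeast_zero_iff _).1 hb)
        have h2 : DimAtLeast (n + 2) X 2 :=
          Or.inr (by rw [show 2 - 1 = 1 from rfl, dimAtLeast_one_iff]; exact hinf)
        exact h2.anti (by omega)
      · obtain ⟨d', rfl⟩ : ∃ d', d = d' + 1 := ⟨d - 1, by omega⟩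
        rw [Nat.add_sub_cancel] at hB
        refine Or.inr ?_
        rw [Nat.add_sub_cancel]
        exact dimAtLeast_succ_of_infinite_slices (infBase X) d' hB

end Rules

end Literature.ModelTheory.PseudofiniteFields
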